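import Mathlib
import Literature.MathematicalPhysics.QuantumFieldTheory.Balaban1983to89.B6Lemma21TowerTorus
import Literature.MathematicalPhysics.QuantumFieldTheory.Balaban1983to89.B10StarCount

/-!
# `Balaban1983to89.B6TorusWindowChart` — T. Bałaban, *Propagators and renormalization transformations for lattice gauge theories. II*,
Commun. Math. Phys. **96** (1984) 223–250 [Balaban1984PropagatorsII]: **the window chart of a torus of the one-scale tower family** — the
coordinates `(x_μ − c_μ) mod N` relative to a corner, in which a cube of the torus `T^{(j)} = Site P j` is read as a cube of `ℤ^d` and (in the
sibling `…B6TorusTransplant`) identified with a smaller torus, as on p. 238: *"We take the cube □̃³ and identify it with a torus, denoted by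
T_□, imposing periodicity conditions"* — with the block bookkeeping (fine chart = `L^K·`unit chart `+` in-block coordinate, neighbouring blocks)

statement-level skeleton of published theorems with citation tags; proofs where landed; nothing here is a claim about the Yang–Mills mass gap

Phase-2 PROOF SEAT p01 (gen 8) of the cell `lit-balaban` (HOME `run/shared/lean/pub/lit-balaban/`), free-target protocol G.5-34(d), own lane
(the one-scale tower-torus lineage `…B6Prop22OneScaleTorus` → … → `…B6Expansion286TowerTorus`).  File 1 of the programme «the MODIFIED
prescription of (2.70) `C_□ = ((Q′G′(□̃)²Q′*)↾□)⁻¹` with `G′(□̃)` on the torus `T_□̃` and the p. 238 change-of-domain sentence, genuine» (files: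
this chart → `…B6TorusCutoffChi` (the smooth cut-off) → `…B6Commutator244TowerTorus` ((2.39)/(2.44) genuine) → the transplant and (2.70)).
Sources read as page images: `run/shared/lean/pub/pub-balaban/b2b-balaban-ref1/pages/1984-cmp96-propagators-rt-II/1984-cmp96-propagators-rt-II
-p007-x2.png` (p. 229), `…-p013-x2.png` (p. 235), `…-p016-x2.png` (p. 238), `…-p017-x2.png` (p. 239); journal page = PDF page + 222.

THE PRINTED TEXT.  p. 238 [PDF 16]: *"A cube □̃ is obtained from □ by taking a sum of 4^d big blocks (of the size M when rescaled to the proper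
scale) with distance to □ equal to 0. … We take the cube □̃³ and identify it with a torus, denoted by T_□, imposing periodicity conditions."*
p. 224 (2.1) and p. 231 (2.46): the blocks `B^j(y)` and the distance `d(y, y′)` (on one scale: the periodic ℓ¹ distance `T1` of this seat's
`…B6Prop22OneScaleTorus`, `…B6Lemma21TowerTorus`).

WHAT THIS FILE PROVES (kernel-checked, 0 sorry, axioms standard; bookkeeping for the siblings, no operator appears): on `Site P j = (ℤ/N_j)^d`,
`woff c x μ = (x_μ − c_μ).val` (`woff_int`: `= (x_μ − c_μ) mod N` as an integer; `eq_of_woff_eq`: the chart is injective); the torus distance is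
below the chart's ℓ¹ distance and EQUALS it when every coordinate difference is `≤ N/2` (`T1_le_sum_abs_woff`, `T1_eq_sum_abs_woff`); with a
block-aligned fine corner `fine P K c` the fine chart of `Site P 0` splits as `L^K·woff(blk x) + (x_μ mod L^K)` (`woff_fine_eq`, `woff_fine_mem`,
`abs_woff_sub_woff_le_of_blk_eq`); the unit shifts move one chart coordinate by `±1 mod N` (`woff_shift_self`/`_of_lt`, `woff_unshift_of_pos`, …);
neighbouring blocks `|blk x − blk(x ± e_μ)|₁ ≤ 1` (`T1_blk_shift_le`, `T1_blk_unshift_le`) and the majorant weights `e^{−δ|blk(x±e_μ) − y′|₁} ≤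
e^δ·e^{−δ|blk x − y′|₁}` (`exp_T1_shift_le`, `exp_T1_unshift_le`).

HONEST SCOPE.  Pure lattice bookkeeping on the tower carriers (tori of sides `2L^{m+K−j}`); every statement is a coordinate identity or a
triangle-inequality consequence; nothing analytic.  Value = the coordinates of the Sect. C device for the siblings, NOT summit progress.
-/

namespace Literature.MathematicalPhysics.QuantumFieldTheory.Balaban1983to89.B6TorusWindowChart

open Finset
open B4TorusKernel.MultiPeriod (circAbs circAbs_nonneg circAbs_add_mul circAbs_of_centred circAbs_le_abs)
open B4Sect5Torus (ccoord ccoord_cast)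
open B1RG242Torus (lvl lvl_of_le sitesPerDir_zero_eq)
open B5Ineq137Torus (blk blk_val fine fine_val toT Nv Nv_pos)
open B6Prop22OneScaleTorus (T1)
open B6Lemma21TowerTorus (T1_triangle T1_symm T1_nonneg)
open B10StarCount (shift_unshift unshift_shift)

noncomputable section

variable (P : Params)

/-! ## §1  The window chart of a torus and the block bookkeeping -/

/-- **The window chart**: the coordinate `(x_μ − c_μ) mod N_j ∈ [0, N_j)` of a site `x` of `T^{(j)} = Site P j` relative to a corner `c` — the
coordinates in which a cube of the torus is read as a cube of `ℤ^d` (and, in the sibling `…B6TorusTransplant`, identified with a smaller torus: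
*"We take the cube □̃³ and identify it with a torus"*). [cite: Balaban1984PropagatorsII, p.238 (Sect. C, the cube □̃³ identified with a torus); bookkeeping] -/
def woff (j : ℕ) (c x : Site P j) (μ : Fin P.d) : ℕ := (x μ - c μ).val

variable {P}

/-- the chart coordinate is `< N_j`. [cite: Balaban1984PropagatorsII, p.238; bookkeeping] -/
theorem woff_lt (j : ℕ) (c x : Site P j) (μ : Fin P.d) : woff P j c x μ < P.sitesPerDir j := ZMod.val_lt _

/-- the chart coordinate as an integer: `(x_μ − c_μ) mod N`. [cite: Balaban1984PropagatorsII, p.238; bookkeeping] -/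
theorem woff_int (j : ℕ) (c x : Site P j) (μ : Fin P.d) :
    (woff P j c x μ : ℤ) = (((x μ).val : ℤ) - ((c μ).val : ℤ)) % (P.sitesPerDir j : ℤ) := by
  unfold woff
  have h : x μ - c μ = (((((x μ).val : ℤ) - ((c μ).val : ℤ)) : ℤ) : ZMod (P.sitesPerDir j)) := by
    push_cast
    rw [ZMod.natCast_zmod_val, ZMod.natCast_zmod_val]
  rw [h, ZMod.val_intCast]

/-- the chart with corner `c` sends `c` to `0`. [cite: Balaban1984PropagatorsII, p.238; bookkeeping] -/
theorem woff_self (j : ℕ) (c : Site P j) (μ : Fin P.d) : woff P j c c μ = 0 := by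
  unfold woff; rw [sub_self, ZMod.val_zero]

/-- differences of chart coordinates are congruent to differences of labels. [cite: Balaban1984PropagatorsII, p.238; bookkeeping] -/
theorem woff_sub_woff_emod (j : ℕ) (c x x' : Site P j) (μ : Fin P.d) :
    ((woff P j c x μ : ℤ) - (woff P j c x' μ : ℤ)) % (P.sitesPerDir j : ℤ) =
      (((x μ).val : ℤ) - ((x' μ).val : ℤ)) % (P.sitesPerDir j : ℤ) := by
  rw [woff_int, woff_int, ← Int.sub_emod]
  congr 1
  ring

/-- the chart is injective coordinatewise (equal chart coordinates ⇒ equal labels). [cite: Balaban1984PropagatorsII, p.238; bookkeeping] -/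
theorem eq_of_woff_eq (j : ℕ) (c : Site P j) {x x' : Site P j} (h : ∀ μ, woff P j c x μ = woff P j c x' μ) : x = x' := by
  funext μ
  have h1 : x μ - c μ = x' μ - c μ := ZMod.val_injective _ (h μ)
  simpa using h1

/-- the circular coordinate distance is the circular distance of the chart coordinates. [cite: Balaban1984PropagatorsII, (2.46) p.231; bookkeeping] -/
theorem ccoord_eq_circAbs_woff (j : ℕ) (c x x' : Site P j) (μ : Fin P.d) :
    ((ccoord (Nv P j) (toT x) (toT x') μ : ℕ) : ℤ) = circAbs (P.sitesPerDir j) ((woff P j c x μ : ℤ) - (woff P j c x' μ : ℤ)) := by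
  rw [ccoord_cast (Nv_pos P j)]
  show circAbs (P.sitesPerDir j) (((x μ).val : ℤ) - ((x' μ).val : ℤ)) = _
  have key : ∀ a b : ℤ, a % (P.sitesPerDir j : ℤ) = b % (P.sitesPerDir j : ℤ) →
      circAbs (P.sitesPerDir j) a = circAbs (P.sitesPerDir j) b := by
    intro a b hab
    unfold circAbs
    rw [hab]
  exact key _ _ (woff_sub_woff_emod j c x x' μ).symm

/-- **`|y − y′|₁ ≤ Σ_μ |chart(y)_μ − chart(y′)_μ|`**: the torus distance (2.46) on one scale is below the chart distance.
[cite: Balaban1984PropagatorsII, (2.46) p.231; bookkeeping] -/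
theorem T1_le_sum_abs_woff (j : ℕ) (c x x' : Site P j) :
    T1 P j x x' ≤ ∑ μ, |((woff P j c x μ : ℤ) : ℝ) - ((woff P j c x' μ : ℤ) : ℝ)| := by
  unfold T1
  have h1 : (1 : ℕ) ≤ P.sitesPerDir j := (P.one_lt_sitesPerDir j).le
  have h : ∀ μ, ((ccoord (Nv P j) (toT x) (toT x') μ : ℕ) : ℝ) ≤
      |((woff P j c x μ : ℤ) : ℝ) - ((woff P j c x' μ : ℤ) : ℝ)| := by
    intro μ
    have hc := ccoord_eq_circAbs_woff j c x x' μ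
    have hle := circAbs_le_abs h1 ((woff P j c x μ : ℤ) - (woff P j c x' μ : ℤ))
    rw [← hc] at hle
    have : (((ccoord (Nv P j) (toT x) (toT x') μ : ℕ) : ℤ) : ℝ) ≤
        ((|(woff P j c x μ : ℤ) - (woff P j c x' μ : ℤ)| : ℤ) : ℝ) := by exact_mod_cast hle
    simpa [Int.cast_abs, Int.cast_sub] using this
  push_cast
  exact Finset.sum_le_sum fun μ _ => h μ

/-- **in the half-window the torus distance IS the chart distance**: if every chart coordinate difference is at most `N/2` in absolute
value, `|y − y′|₁ = Σ_μ |chart(y)_μ − chart(y′)_μ|`. [cite: Balaban1984PropagatorsII, (2.46) p.231; bookkeeping] -/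
theorem T1_eq_sum_abs_woff (j : ℕ) (c x x' : Site P j)
    (hhalf : ∀ μ, 2 * |(woff P j c x μ : ℤ) - (woff P j c x' μ : ℤ)| ≤ P.sitesPerDir j) :
    T1 P j x x' = ∑ μ, |((woff P j c x μ : ℤ) : ℝ) - ((woff P j c x' μ : ℤ) : ℝ)| := by
  unfold T1
  have h1 : (1 : ℕ) ≤ P.sitesPerDir j := (P.one_lt_sitesPerDir j).le
  have h : ∀ μ, ((ccoord (Nv P j) (toT x) (toT x') μ : ℕ) : ℝ) =
      |((woff P j c x μ : ℤ) : ℝ) - ((woff P j c x' μ : ℤ) : ℝ)| := by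
    intro μ
    have hc := ccoord_eq_circAbs_woff j c x x' μ
    rw [circAbs_of_centred h1 (hhalf μ)] at hc
    have : (((ccoord (Nv P j) (toT x) (toT x') μ : ℕ) : ℤ) : ℝ) =
        ((|(woff P j c x μ : ℤ) - (woff P j c x' μ : ℤ)| : ℤ) : ℝ) := by exact_mod_cast hc
    simpa [Int.cast_abs, Int.cast_sub] using this
  push_cast
  exact Finset.sum_congr rfl fun μ _ => h μ

/-- **fine chart vs unit chart**: with the corner representative `fine P K c` of the unit corner `c` as fine corner, the fine chart
coordinate splits as `L^K·(unit chart of the block) + (in-block coordinate)` — blocks never straddle the seam of a block-aligned chart.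
[cite: Balaban1984PropagatorsII, (2.1) p.224 (the blocks B^j(y)); bookkeeping] -/
theorem woff_fine_eq (c : Site P P.K) (x : Site P 0) (μ : Fin P.d) :
    woff P 0 (fine P P.K c) x μ = P.L ^ P.K * woff P P.K c (blk P P.K x) μ + (x μ).val % P.L ^ P.K := by
  have hK : P.K ≤ P.m + P.K := Nat.le_add_left _ _
  have hN0 : P.sitesPerDir 0 = P.L ^ P.K * P.sitesPerDir P.K := by
    have := sitesPerDir_zero_eq P P.K; rwa [lvl_of_le P hK] at this
  set n := P.L ^ P.K with hn
  set N := P.sitesPerDir P.K with hNdef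
  have hnpos : 0 < n := pow_pos P.L_pos _
  have hNpos : 0 < N := Nat.pos_of_ne_zero (P.sitesPerDir_ne_zero _)
  have hN0' : ((P.sitesPerDir 0 : ℕ) : ℤ) = (n : ℤ) * (N : ℤ) := by rw [hN0]; push_cast; rfl
  apply Int.ofNat_inj.mp
  have lhs := woff_int 0 (fine P P.K c) x μ
  have rhs := woff_int P.K c (blk P P.K x) μ
  rw [fine_val P hK] at lhs
  rw [blk_val P hK] at rhs
  push_cast
  rw [lhs, hN0', rhs]
  set a := (x μ).val with ha
  set cv := (c μ).val with hcv
  have hdiv : (a : ℤ) = n * (a / n : ℕ) + (a % n : ℕ) := by exact_mod_cast (Nat.div_add_mod a n).symm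
  have hr : ((a % n : ℕ) : ℤ) < n := by exact_mod_cast Nat.mod_lt a hnpos
  have hr0 : (0 : ℤ) ≤ ((a % n : ℕ) : ℤ) := by positivity
  set q : ℤ := ((a / n : ℕ) : ℤ) with hq
  set r : ℤ := ((a % n : ℕ) : ℤ) with hrr
  set s : ℤ := (q - cv) % (N : ℤ) with hs
  have hs0 : 0 ≤ s := Int.emod_nonneg _ (by exact_mod_cast hNpos.ne')
  have hsN : s < N := Int.emod_lt_of_pos _ (by exact_mod_cast hNpos)
  have hqs : (q - cv) = N * ((q - cv) / N) + s := (Int.mul_ediv_add_emod _ _).symm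
  have e : (a : ℤ) - ((n * cv : ℕ) : ℤ) = (n * s + r) + ((n : ℤ) * N) * ((q - cv) / N) := by
    push_cast
    rw [hdiv]
    linear_combination (n : ℤ) * hqs
  rw [e, Int.add_mul_emod_self_left]
  have hlt : n * s + r < (n : ℤ) * N := by nlinarith
  rw [Int.emod_eq_of_lt (by positivity) hlt, hrr]
  push_cast
  ring

/-- block-mates have fine chart coordinates in the same `L^K`-window: `|chart(x)_μ − chart(x′)_μ| ≤ L^K − 1`.
[cite: Balaban1984PropagatorsII, (2.1) p.224; bookkeeping] -/
theorem abs_woff_sub_woff_le_of_blk_eq (c : Site P P.K) {x x' : Site P 0} (h : blk P P.K x = blk P P.K x') (μ : Fin P.d) :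
    |(woff P 0 (fine P P.K c) x μ : ℤ) - (woff P 0 (fine P P.K c) x' μ : ℤ)| ≤ ((P.L ^ P.K : ℕ) : ℤ) - 1 := by
  rw [woff_fine_eq c x μ, woff_fine_eq c x' μ, h]
  set n := P.L ^ P.K with hn'
  have hn : 0 < n := pow_pos P.L_pos _
  have h1 : (x μ).val % n < n := Nat.mod_lt _ hn
  have h2 : (x' μ).val % n < n := Nat.mod_lt _ hn
  set w := woff P P.K c (blk P P.K x') μ with hw
  have e : ((n * w + (x μ).val % n : ℕ) : ℤ) - ((n * w + (x' μ).val % n : ℕ) : ℤ) =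
      (((x μ).val % n : ℕ) : ℤ) - (((x' μ).val % n : ℕ) : ℤ) := by push_cast; ring
  rw [e, abs_le]
  constructor <;> omega

/-- the fine chart coordinate of a site lies in the `L^K`-window of its block: `L^K·u ≤ woff ≤ L^K·u + L^K − 1`, `u` the unit chart
coordinate of the block. [cite: Balaban1984PropagatorsII, (2.1) p.224; bookkeeping] -/
theorem woff_fine_mem (c : Site P P.K) (x : Site P 0) (μ : Fin P.d) :
    P.L ^ P.K * woff P P.K c (blk P P.K x) μ ≤ woff P 0 (fine P P.K c) x μ ∧
      woff P 0 (fine P P.K c) x μ + 1 ≤ P.L ^ P.K * woff P P.K c (blk P P.K x) μ + P.L ^ P.K := by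
  rw [woff_fine_eq c x μ]
  have hn : 0 < P.L ^ P.K := pow_pos P.L_pos _
  have h1 : (x μ).val % P.L ^ P.K < P.L ^ P.K := Nat.mod_lt _ hn
  generalize (x μ).val % P.L ^ P.K = r at h1 ⊢
  constructor <;> omega

/-! ### the unit shift in the chart -/

/-- `chart(x + e_μ)_μ = (chart(x)_μ + 1) mod N`. [cite: Balaban1984PropagatorsII, p.238; bookkeeping] -/
theorem woff_shift_self (j : ℕ) (c x : Site P j) (μ : Fin P.d) :
    woff P j c (x.shift μ) μ = (woff P j c x μ + 1) % P.sitesPerDir j := by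
  unfold woff Site.shift
  rw [Function.update_self, show x μ + 1 - c μ = (x μ - c μ) + 1 by ring, ZMod.val_add, ZMod.val_one]

/-- the other chart coordinates of `x + e_μ` are those of `x`. [cite: Balaban1984PropagatorsII, p.238; bookkeeping] -/
theorem woff_shift_ne (j : ℕ) (c x : Site P j) {μ ν : Fin P.d} (h : ν ≠ μ) :
    woff P j c (x.shift μ) ν = woff P j c x ν := by
  unfold woff Site.shift
  rw [Function.update_of_ne h]

/-- the other chart coordinates of `x − e_μ` are those of `x`. [cite: Balaban1984PropagatorsII, p.238; bookkeeping] -/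
theorem woff_unshift_ne (j : ℕ) (c x : Site P j) {μ ν : Fin P.d} (h : ν ≠ μ) :
    woff P j c (x.unshift μ) ν = woff P j c x ν := by
  unfold woff Site.unshift
  rw [Function.update_of_ne h]

/-- `chart(x)_μ = (chart(x − e_μ)_μ + 1) mod N`. [cite: Balaban1984PropagatorsII, p.238; bookkeeping] -/
theorem woff_unshift_self (j : ℕ) (c x : Site P j) (μ : Fin P.d) :
    woff P j c x μ = (woff P j c (x.unshift μ) μ + 1) % P.sitesPerDir j := by
  conv_lhs => rw [← shift_unshift x μ]
  exact woff_shift_self j c _ μ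

/-- away from the upper seam the shift adds one: `chart(x)_μ + 1 < N ⇒ chart(x + e_μ)_μ = chart(x)_μ + 1`.
[cite: Balaban1984PropagatorsII, p.238; bookkeeping] -/
theorem woff_shift_of_lt (j : ℕ) (c x : Site P j) (μ : Fin P.d) (h : woff P j c x μ + 1 < P.sitesPerDir j) :
    woff P j c (x.shift μ) μ = woff P j c x μ + 1 := by
  rw [woff_shift_self, Nat.mod_eq_of_lt h]

/-- away from the lower seam the backward shift subtracts one: `1 ≤ chart(x)_μ ⇒ chart(x − e_μ)_μ = chart(x)_μ − 1`.
[cite: Balaban1984PropagatorsII, p.238; bookkeeping] -/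
theorem woff_unshift_of_pos (j : ℕ) (c x : Site P j) (μ : Fin P.d) (h : 1 ≤ woff P j c x μ) :
    woff P j c (x.unshift μ) μ = woff P j c x μ - 1 := by
  have h1 := woff_unshift_self j c x μ
  have hlt := woff_lt j c (x.unshift μ) μ
  rcases Nat.lt_or_ge (woff P j c (x.unshift μ) μ + 1) (P.sitesPerDir j) with h2 | h2
  · rw [Nat.mod_eq_of_lt h2] at h1; omega
  · have heq : woff P j c (x.unshift μ) μ + 1 = P.sitesPerDir j := by omega
    rw [heq, Nat.mod_self] at h1; omega

/-! ### neighbouring blocks -/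

/-- a pair of sites differing only in the coordinate `μ`, there by a circular distance `≤ 1`, is at `|·|₁`-distance `≤ 1`.
[cite: Balaban1984PropagatorsII, (2.46) p.231; bookkeeping] -/
theorem T1_le_one_of {j : ℕ} {y y' : Site P j} {μ : Fin P.d} (hne : ∀ ν, ν ≠ μ → y ν = y' ν)
    (hμ : ccoord (Nv P j) (toT y) (toT y') μ ≤ 1) : T1 P j y y' ≤ 1 := by
  unfold T1
  have h0 : ∀ ν, ν ≠ μ → ccoord (Nv P j) (toT y) (toT y') ν = 0 := by
    intro ν hν
    unfold ccoord
    have : ((toT y ν).val : ℤ) - ((toT y' ν).val : ℤ) = 0 := by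
      show (((y ν).val : ℕ) : ℤ) - (((y' ν).val : ℕ) : ℤ) = 0
      rw [hne ν hν, sub_self]
    rw [this, B4Sect5Torus.circAbs_zero]
    rfl
  have hsum : ∑ ν, ccoord (Nv P j) (toT y) (toT y') ν = ccoord (Nv P j) (toT y) (toT y') μ := by
    rw [Finset.sum_eq_single μ (fun ν _ hν => h0 ν hν) (fun h => (h (Finset.mem_univ μ)).elim)]
  rw [hsum]
  exact_mod_cast hμ

/-- the circular distance of two labels differing by at most one (possibly across the seam `N − 1 ∣ 0`) is `≤ 1`.
[cite: Balaban1984PropagatorsII, (2.46) p.231; bookkeeping] -/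
theorem circAbs_toNat_le_one {N : ℕ} (hN : 1 ≤ N) {a b : ℤ} (h : |a - b| ≤ 1 ∨ |a - b - N| ≤ 1 ∨ |a - b + N| ≤ 1) :
    (circAbs N (a - b)).toNat ≤ 1 := by
  have key : circAbs N (a - b) ≤ 1 := by
    rcases h with h | h | h
    · exact (circAbs_le_abs hN _).trans h
    · have e : a - b = (a - b - N) + N * 1 := by ring
      rw [e, circAbs_add_mul]
      exact (circAbs_le_abs hN _).trans h
    · have e : a - b = (a - b + N) + N * (-1) := by ring
      rw [e, circAbs_add_mul]
      exact (circAbs_le_abs hN _).trans h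
  have h0 := circAbs_nonneg hN (a - b)
  omega

/-- the label of the block of `x + e_μ` in direction `μ`: `⌊(x_μ+1)/L^K⌋` (no wrap) or `0` (wrap at the end of the torus).
[cite: Balaban1984PropagatorsII, (2.1) p.224; bookkeeping] -/
theorem blk_shift_val (x : Site P 0) (μ : Fin P.d) :
    ((blk P P.K (x.shift μ) μ).val = ((x μ).val + 1) / P.L ^ P.K ∧ (x μ).val + 1 < P.sitesPerDir 0) ∨
      ((blk P P.K (x.shift μ) μ).val = 0 ∧ (x μ).val + 1 = P.sitesPerDir 0) := by
  have hKle : P.K ≤ P.m + P.K := Nat.le_add_left _ _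
  have hv : ((x.shift μ) μ).val = ((x μ).val + 1) % P.sitesPerDir 0 := by
    unfold Site.shift
    rw [Function.update_self, ZMod.val_add, ZMod.val_one]
  rw [blk_val P hKle, hv]
  have hlt : (x μ).val < P.sitesPerDir 0 := ZMod.val_lt _
  rcases Nat.lt_or_ge ((x μ).val + 1) (P.sitesPerDir 0) with h | h
  · left
    exact ⟨by rw [Nat.mod_eq_of_lt h], h⟩
  · right
    have heq : (x μ).val + 1 = P.sitesPerDir 0 := le_antisymm hlt h
    exact ⟨by rw [heq, Nat.mod_self, Nat.zero_div], heq⟩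

/-- **neighbouring blocks**: `|blk(x) − blk(x + e_μ)|₁ ≤ 1`. [cite: Balaban1984PropagatorsII, (2.1) p.224, (2.46) p.231; bookkeeping] -/
theorem T1_blk_shift_le (x : Site P 0) (μ : Fin P.d) :
    T1 P P.K (blk P P.K x) (blk P P.K (x.shift μ)) ≤ 1 := by
  have hKle : P.K ≤ P.m + P.K := Nat.le_add_left _ _
  have hN0 : P.sitesPerDir 0 = P.L ^ P.K * P.sitesPerDir P.K := by
    have := sitesPerDir_zero_eq P P.K; rwa [lvl_of_le P hKle] at this
  set n := P.L ^ P.K with hn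
  set N := P.sitesPerDir P.K with hNdef
  have hnpos : 0 < n := pow_pos P.L_pos _
  have hN1 : 1 ≤ N := (P.one_lt_sitesPerDir P.K).le
  refine T1_le_one_of (μ := μ) (fun ν hν => ?_) ?_
  · show blk P P.K x ν = blk P P.K (x.shift μ) ν
    unfold blk Site.shift
    rw [Function.update_of_ne hν]
  · unfold ccoord
    show (circAbs (P.sitesPerDir P.K) (((blk P P.K x μ).val : ℤ) - ((blk P P.K (x.shift μ) μ).val : ℤ))).toNat ≤ 1
    rw [blk_val P hKle, ← hn]
    rcases blk_shift_val x μ with ⟨hv, hlt⟩ | ⟨hv, heq⟩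
    · rw [hv, ← hn]
      refine circAbs_toNat_le_one hN1 (Or.inl ?_)
      have h1 : (x μ).val / n ≤ ((x μ).val + 1) / n := Nat.div_le_div_right (Nat.le_succ _)
      have h2 : ((x μ).val + 1) / n ≤ (x μ).val / n + 1 := by
        have : ((x μ).val + 1) / n ≤ ((x μ).val + n) / n := Nat.div_le_div_right (by omega)
        rwa [Nat.add_div_right _ hnpos] at this
      rw [abs_le]
      constructor <;> omega
    · rw [hv]
      refine circAbs_toNat_le_one hN1 (Or.inr (Or.inl ?_))
      have hq : (x μ).val / n = N - 1 := by
        have e : (x μ).val = n * (N - 1) + (n - 1) := by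
          have : (x μ).val + 1 = n * N := by rw [heq, hN0]
          have hN' : 1 ≤ N := hN1
          zify [hN', Nat.one_le_iff_ne_zero.mpr hnpos.ne'] at this ⊢
          linear_combination this
        rw [e, Nat.mul_add_div hnpos, Nat.div_eq_of_lt (by omega), add_zero]
      rw [hq]
      have : ((N - 1 : ℕ) : ℤ) = (N : ℤ) - 1 := by
        rw [Nat.cast_sub hN1]; simp
      rw [this]
      norm_num

/-- **neighbouring blocks**, backward: `|blk(x) − blk(x − e_μ)|₁ ≤ 1`. [cite: Balaban1984PropagatorsII, (2.1) p.224, (2.46) p.231; bookkeeping] -/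
theorem T1_blk_unshift_le (x : Site P 0) (μ : Fin P.d) :
    T1 P P.K (blk P P.K x) (blk P P.K (x.unshift μ)) ≤ 1 := by
  have h := T1_blk_shift_le (x.unshift μ) μ
  rw [shift_unshift] at h
  rwa [T1_symm]

/-- the majorant weight of a neighbouring block: `e^{−δ|blk(x−e_μ) − y′|₁} ≤ e^{δ}·e^{−δ|blk(x) − y′|₁}` (`δ ≥ 0`).
[cite: Balaban1984PropagatorsII, (2.46) p.231, (2.54) p.233; bookkeeping] -/
theorem exp_T1_unshift_le {δ : ℝ} (hδ : 0 ≤ δ) (x : Site P 0) (μ : Fin P.d) (y' : Site P P.K) :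
    Real.exp (-(δ * T1 P P.K (blk P P.K (x.unshift μ)) y')) ≤
      Real.exp δ * Real.exp (-(δ * T1 P P.K (blk P P.K x) y')) := by
  rw [← Real.exp_add]
  apply Real.exp_le_exp.mpr
  have h1 := T1_blk_unshift_le x μ
  have h2 := T1_triangle P P.K (blk P P.K x) (blk P P.K (x.unshift μ)) y'
  nlinarith

/-- the same for the forward neighbour. [cite: Balaban1984PropagatorsII, (2.46) p.231, (2.54) p.233; bookkeeping] -/
theorem exp_T1_shift_le {δ : ℝ} (hδ : 0 ≤ δ) (x : Site P 0) (μ : Fin P.d) (y' : Site P P.K) :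
    Real.exp (-(δ * T1 P P.K (blk P P.K (x.shift μ)) y')) ≤
      Real.exp δ * Real.exp (-(δ * T1 P P.K (blk P P.K x) y')) := by
  rw [← Real.exp_add]
  apply Real.exp_le_exp.mpr
  have h1 := T1_blk_shift_le x μ
  have h2 := T1_triangle P P.K (blk P P.K x) (blk P P.K (x.shift μ)) y'
  nlinarith



end

end Literature.MathematicalPhysics.QuantumFieldTheory.Balaban1983to89.B6TorusWindowChart
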